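import Literature.Geometry.Riemannian.CutLocusBuchnerOMinimal
import Literature.Geometry.Manifold.DefinableEmbeddingOMinimal
import HarnessLib

/-!
# Buchner 1977 from the o-minimality of ANY expansion of the real field defining the restricted
# analytic functions

Proof file (theorems only) for the named fact
`Literature.Geometry.Riemannian.buchner1977_cutLocus_triangulable` (M. A. Buchner, *Simplicial
structure of the real analytic cut locus*, Proc. AMS 64 (1977), Theorem p. 118: the cut locus of a
compact real analytic Riemannian manifold is homeomorphic to a finite simplicial complex of
dimension `≤ n - 1`).

`CutLocusBuchnerOMinimal.lean` reduces the fact to ONE hypothesis, the tree's named fact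
`VandendriesMiller1994_realAnExp_isOMinimal` (`ℝ_an,exp` is o-minimal — van den Dries–Miller 1994 /
van den Dries–Macintyre–Marker 1994, whose proof rests on Wilkie-type model completeness for `exp`
ON TOP of the theory of `ℝ_an`). The exponential plays no role in Buchner's theorem: the cut locus
is the image of a bounded subanalytic set under an analytic map, a *globally subanalytic* object.
This file records the sharper reduction: Buchner's theorem follows from the o-minimality of ANY
first-order expansion `L` of the ordered field `(ℝ, <, +, ·)` in which every restricted analytic
function `[0,1]ⁿ → ℝ` (`RestrictedAnalytic.restrict`, Pila 2022, 8.21) is definable — in particular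
from the o-minimality of `ℝ_an` alone (Gabrielov 1968, *Projections of semianalytic sets*;
Denef–van den Dries 1988, *p-adic and real subanalytic sets*, §4; van den Dries–Miller 1994,
Introduction), which the tree does not yet carry as a named fact, as well as from the o-minimality of
`ℝ_an,exp` (recovering `buchner1977_cutLocus_triangulable_of_realAnExp_isOMinimal`).

Road: `TCL(p)` bounded subanalytic ⇒ `L`-definable (`RestrictedAnalyticDefinable.lean`);
`C(p) = exp_p(TCL(p))` closed, `exp_p` analytic ⇒ `C(p) ≃ₜ X` with `X ⊆ ℝᴺ` compact `L`-definable
(`DefinableEmbeddingOMinimal.lean`); compact definable sets in o-minimal expansions of the real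
field are polyhedra (`OMinimalTriangulation.lean`, van den Dries 1998, Ch. 8 (2.9), proved in the
tree); dimension clause and Euclidean carrier by `buchner1977_cutLocus_triangulable_of_homeomorph_pi`.

## Main statements (all proved)

* `exists_definable_homeomorph_cutLocus_of_restrictedAnalytic` — `C(p) ≃ₜ X`, `X ⊆ ℝᴺ` compact and
  `L`-definable, for every expansion `L` of the real field defining the restricted analytic functions.
* `buchner1977_cutLocus_triangulable_of_triangulation_of_restrictedAnalytic` — Buchner's theorem
  from the triangulability of compact `L`-definable sets, `L` as above.
* `buchner1977_cutLocus_triangulable_of_isOMinimal_expansion` — **Buchner's theorem from the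
  o-minimality of any expansion `L` of `Language.orderedRing` on `ℝ` defining the restricted
  analytic functions.**
* an unnamed `example` re-deriving the case `L = ℝ_an,exp` (the statement of the tree's
  `buchner1977_cutLocus_triangulable_of_realAnExp_isOMinimal`) through the general reduction, as a
  consistency check.

## References

* [Buchner1977Simplicial] M. A. Buchner, Proc. AMS 64 (1977) 118–121, Theorem p. 118.
* [Dries1998] L. van den Dries, *Tame topology and o-minimal structures* (1998), Ch. 8 (2.9).
* [VandendriesMiller1994] L. van den Dries, C. Miller, Israel J. Math. 85 (1994), Introduction
  (`ℝ_an`, `ℝ_an,exp`).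
* [Pila2022] J. Pila, *Point-counting and the Zilber–Pink conjecture* (2022), 8.21, Thm. 8.26.
-/

noncomputable section

open Bundle Set Function Filter Metric FirstOrder
open scoped Manifold ContDiff Topology

namespace Literature.Geometry.Riemannian

open Literature.Geometry.Lorentzian
open Literature.Geometry.Lorentzian.PseudoRiemannianMetric
open Literature.Geometry.Manifold
open Literature.ModelTheory.ExponentialFields

universe u v w u' v'

section CutLocus

variable {E : Type*} [NormedAddCommGroup E] [NormedSpace ℝ E] [FiniteDimensional ℝ E]
  {H : Type*} [TopologicalSpace H] {I : ModelWithCorners ℝ E H} [I.Boundaryless]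
  {M : Type*} [TopologicalSpace M] [ChartedSpace H M] [IsManifold I ω M]
  [CompactSpace M] [T2Space M] [ConnectedSpace M]

/-- **The cut locus of a point of a compact real-analytic Riemannian manifold is homeomorphic to a
compact `L`-definable subset of some `ℝᴺ`, for every expansion `L` of the real field defining the
restricted analytic functions**: `C(p) = exp_p(TCL(p))` with `exp_p` analytic and `TCL(p)` bounded
subanalytic, and `C(p)` is closed; apply
`exists_definable_homeomorph_of_eq_image_of_restrictedAnalytic`.
[cite: Buchner1977Simplicial, pp. 118–121] -/
theorem exists_definable_homeomorph_cutLocus_of_restrictedAnalytic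
    {L : FirstOrder.Language.{u', v'}} [L.Structure ℝ] (hL : IsRealFieldExpansion L)
    (hAn : ∀ (n : ℕ) (f : RestrictedAnalytic n), (univ : Set ℝ).DefinableFun L f.restrict)
    (g : PseudoRiemannianMetric I ω E (TangentSpace I : M → Type _)) (hg : g.IsRiemannian) (p : M) :
    ∃ (N : ℕ) (X : Set (Fin N → ℝ)), IsCompact X ∧
      (univ : Set ℝ).Definable L X ∧ Nonempty (cutLocus g hg p ≃ₜ X) := by
  haveI : CompleteSpace E := FiniteDimensional.complete ℝ E
  haveI : Fact (1 ≤ (ω : ℕ∞ω)) := ⟨le_top⟩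
  haveI : g.HasLeviCivita := g.hasLeviCivita
  haveI : CovariantDerivative.ContMDiffCovariantDerivative g.leviCivita 1 :=
    ⟨g.isLocallyContMDiff_leviCivita_holds 1 le_top univ isOpen_univ⟩
  have hc : IsGeodesicallyComplete g.leviCivita :=
    g.isGeodesicallyComplete_of_compactSpace (le_top : (2 : ℕ∞ω) ≤ ω) hg
  exact exists_definable_homeomorph_of_eq_image_of_restrictedAnalytic I hL hAn
    (ex := fun v : E => expMap g.leviCivita p (show TangentSpace I p from v))
    (contMDiff_riemannianExpMap_omega g hc p) (isSubanalytic_tangentCutLocus g hg p)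
    (isBounded_tangentCutLocus g hg p) (isClosed_cutLocus_of_compactSpace g le_top hg p)
    (cutLocus_eq_image_tangentCutLocus g hg p)

end CutLocus

/-! ## Buchner's theorem from the o-minimality of an expansion defining the restricted analytic
functions -/

section Reduction

/-- **Buchner 1977 from the triangulability of compact `L`-definable sets**, `L` any expansion of
the real field defining the restricted analytic functions: if every compact `L`-definable subset of
every `ℝᴺ` is homeomorphic to the polyhedron of a finite simplicial complex, then the cut locus of
every point of every compact real-analytic Riemannian manifold is homeomorphic to a finite
simplicial complex of dimension `≤ n - 1` in a Euclidean space.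
[cite: Buchner1977Simplicial, pp. 118–121] -/
theorem buchner1977_cutLocus_triangulable_of_triangulation_of_restrictedAnalytic
    {L : FirstOrder.Language.{u', v'}} [L.Structure ℝ] (hL : IsRealFieldExpansion L)
    (hAn : ∀ (n : ℕ) (f : RestrictedAnalytic n), (univ : Set ℝ).DefinableFun L f.restrict)
    (hT : ∀ (N : ℕ) (X : Set (Fin N → ℝ)), (univ : Set ℝ).Definable L X →
      IsCompact X → ∃ (n : ℕ) (K : Geometry.SimplicialComplex ℝ (Fin n → ℝ)),
        K.faces.Finite ∧ Nonempty (X ≃ₜ K.space)) :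
    buchner1977_cutLocus_triangulable.{u, v, w} := by
  refine buchner1977_cutLocus_triangulable_of_homeomorph_pi ?_
  intro E _ _ _ H _ I _ M _ _ _ _ _ _ g hg p
  obtain ⟨N, X, hXc, hXd, ⟨φ⟩⟩ := exists_definable_homeomorph_cutLocus_of_restrictedAnalytic hL hAn g hg p
  obtain ⟨n, K, hK, ⟨ψ⟩⟩ := hT N X hXd hXc
  exact ⟨n, K, hK, ⟨φ.trans ψ⟩⟩

/-- **Buchner 1977 from the o-minimality of any expansion of the ordered field of real numbers in
which the restricted analytic functions are definable.** Hypotheses: a first-order language `L` on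
`ℝ` expanding `Language.orderedRing` along `φ` (the convention of the tree's o-minimal files), with
`L.IsOMinimal ℝ`, such that every restricted analytic function `[0,1]ⁿ → ℝ` (extended by `0`) is an
`L`-definable function (`L` is explicit, as in the hypothesis `hT` of
`buchner1977_cutLocus_triangulable_of_isOMinimal`). Conclusion: `buchner1977_cutLocus_triangulable`
(Theorem p. 118 of Buchner, including the dimension bound). Instances: `L = ℝ_an` (o-minimal by Gabrielov 1968 / Denef–van den
Dries 1988 — not yet a fact of the tree), `L = ℝ_an,exp` (van den Dries–Miller 1994, the tree's
`VandendriesMiller1994_realAnExp_isOMinimal`; see the `example` at the end of this file and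
`buchner1977_cutLocus_triangulable_of_realAnExp_isOMinimal`). The triangulation of compact
definable sets is the tree's `exists_homeomorph_space_of_definable_isCompact` (van den Dries 1998,
Ch. 8 (2.9)). [cite: Buchner1977Simplicial, Theorem p. 118] [cite: Dries1998, Ch. 8 (2.9)]
[cite: VandendriesMiller1994, Introduction] -/
theorem buchner1977_cutLocus_triangulable_of_isOMinimal_expansion
    (L : FirstOrder.Language.{0, 0}) [L.Structure ℝ] (φ : Language.orderedRing →ᴸ L)
    [φ.IsExpansionOn ℝ] (hO : L.IsOMinimal ℝ)
    (hAn : ∀ (n : ℕ) (f : RestrictedAnalytic n), (univ : Set ℝ).DefinableFun L f.restrict) :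
    buchner1977_cutLocus_triangulable.{u, v, w} :=
  buchner1977_cutLocus_triangulable_of_triangulation_of_restrictedAnalytic.{u, v, w}
    (IsRealFieldExpansion.of_expansion φ) hAn
    fun N X hX hXc => exists_homeomorph_space_of_definable_isCompact φ hO N X hX hXc

/-- **The case `L = ℝ_an,exp`, as a consistency check** (re-derivation of the statement of the
tree's `buchner1977_cutLocus_triangulable_of_realAnExp_isOMinimal` through the general reduction; an
unnamed `example`, the named survivor being the existing theorem): `ℝ_an,exp` expands the ordered
ring along `Language.orderedExpRing.toRealAnExp ∘ orderedRingHomOrderedExpRing`, and its restricted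
analytic symbols are definable functions (`realAnExp_definableFun_restrict`).
[cite: Buchner1977Simplicial, Theorem p. 118] [cite: VandendriesMiller1994] -/
example (hO : Literature.ModelTheory.ExponentialFields.VandendriesMiller1994_realAnExp_isOMinimal) :
    buchner1977_cutLocus_triangulable.{u, v, w} := by
  -- `ℝ_an,exp` expands the ordered ring: compose the two expansions of the tree
  haveI : (Language.orderedExpRing.toRealAnExp.comp orderedRingHomOrderedExpRing).IsExpansionOn ℝ :=
    { map_onFunction := fun f x => by
        show FirstOrder.Language.Structure.funMap (Language.orderedExpRing.toRealAnExp.onFunction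
          (orderedRingHomOrderedExpRing.onFunction f)) x = _
        rw [FirstOrder.Language.LHom.map_onFunction, FirstOrder.Language.LHom.map_onFunction]
      map_onRelation := fun R x => by
        show FirstOrder.Language.Structure.RelMap (Language.orderedExpRing.toRealAnExp.onRelation
          (orderedRingHomOrderedExpRing.onRelation R)) x = _
        rw [FirstOrder.Language.LHom.map_onRelation, FirstOrder.Language.LHom.map_onRelation] }
  exact @buchner1977_cutLocus_triangulable_of_isOMinimal_expansion.{u, v, w} Language.realAnExp _
    (Language.orderedExpRing.toRealAnExp.comp orderedRingHomOrderedExpRing) _ hO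
    realAnExp_definableFun_restrict

end Reduction

end Literature.Geometry.Riemannian
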